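import Summits.CriticalPhenomena.PercolationContinuityZ3.Theorems.PercNearOneGluingAdditiveGluingObsLemma4Mult
import HarnessLib

/-!
# Crux `PercNearOneGluing.AdditiveGluing` (stmt-CriticalPhenomena-4576), line `tieline`: the mixture Lemma 4 (ML4)
# from the SHARP mixture inequality (SML4)

Support file (`--supports stmt-CriticalPhenomena-4576`, lead c9, line `starglue/tieline`).  No definitions, no named facts,
no sorries.

Weighted graph on a finite vertex type (`μ = prodBernoulli w`), target `b`, a pair `{u, v}` to be glued with `u` the WEAKER
endpoint (`τ_u = μ(u ↔ b) ≤ μ(v ↔ b) = τ_v`), a spectator `c`, an observer `o`.  Events: `O_x = {o ↔ x}`, `B_x = {x ↔ b}`,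
`C_x = {c ↔ x}`, `D = {u ↮ v}`, `N = {c ↮ u} ∩ {c ↮ v}`, weights `ψ_A = μ(N ∩ (O_u ∪ O_v))`, `ψ_c = μ(N ∩ O_c)`, gains
`G_x = μ({x ↮ b} ∩ ({x ↔ u} ∪ {x ↔ v}) ∩ (B_u ∪ B_v))` (the pair is pivotal for `x ↔ b`).

* **SML4** (the sharp mixture inequality, registered stub `stub_sharpMixtureLemma4_c9` of the skeleton):
  `ψ_c · [μ(O_u ∩ B_v ∩ D ∩ C_uᶜ) + μ(O_v ∩ B_u ∩ D ∩ C_vᶜ) − μ(O_v ∩ B_v ∩ D ∩ C_u) − μ(O_u ∩ B_u ∩ D ∩ C_v)]`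
  `≤ ψ_A · [μ(N ∩ O_c ∩ B_v ∩ D) + μ(O_v ∩ B_v ∩ D) − μ(O_v ∩ B_u ∩ D)]`.
  It is an EQUALITY when the observer's neighbourhood is `{u, c}` (both sides factor through `G ∖ o`), and numerically it has no
  violation (lead c9: exact enumeration, 5 000 random instances on 5–8 vertices, adversarial annealing).
* **ML4** (registered stub `stub_mixtureLemma4_c8`): `(ψ_A + ψ_c)·G_o ≤ ψ_A·(μ(B_u ∪ B_v) − min(τ_u, τ_v)) + ψ_c·G_c`.

This file proves `ML4 ⟸ SML4` (`SharpML4.ml4_of_sharp`, and the stub-shaped `mixtureLemma4_of_sharp`) by event inclusions only: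
`G_o ≤ μ(O_u ∩ B_v ∩ D) + μ(O_v ∩ B_u ∩ D)` (`ObsLemma4Mult.gain_subset`); the three events `O_u ∩ B_v ∩ D`, `O_v ∩ B_v ∩ D`,
`N ∩ O_c ∩ B_v ∩ D` are pairwise disjoint inside `B_v ∩ D = B_v ∖ B_u` (whose mass is `μ(B_u ∪ B_v) − τ_u = max_j G`);
`G_c ≥ μ(C_u ∩ B_v ∩ D) + μ(C_v ∩ B_u ∩ D)`; and `C_u ∩ B_v ∩ D ⊇ (O_u ∩ B_v ∩ D ∩ C_u) ⊔ (O_v ∩ B_v ∩ D ∩ C_u)` (symmetrically in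
`u, v`).  [cite: KozmaNitzan2024, Lemma 4 / eq. (8)–(9) (pp. 9–10), Theorem 1 / (6) (pp. 7–8)]
-/

namespace Summit.CriticalPhenomena.PercolationContinuityZ3.Theorems

open MeasureTheory Set Literature.Probability.LatticeModels Literature.Probability.Percolation

noncomputable section
open Classical

namespace SharpML4

variable {V : Type*}

/-! ### Set-theoretic facts (all connections are `SimpleGraph.Reachable` in the open subgraph) -/

/-- `B_v ∖ B_u = B_v ∩ D`: if `v ↔ b` then `u ↮ b ↔ u ↮ v`. [folklore] -/
theorem Bv_diff_Bu_eq (b u v : V) :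
    ((openConn v b : Set (BondConfig V)) \ openConn u b) = openConn v b ∩ (openConn u v)ᶜ := by
  ext ω
  simp only [mem_sdiff, mem_inter_iff, mem_compl_iff, openConn, mem_setOf_eq]
  constructor
  · rintro ⟨hvb, hub⟩
    exact ⟨hvb, fun huv => hub (huv.trans hvb)⟩
  · rintro ⟨hvb, huv⟩
    exact ⟨hvb, fun hub => huv (hub.trans hvb.symm)⟩

/-- The three observer positions `o ∈ C(u)`, `o ∈ C(v)`, `o ∈ C(c)` (with `c ↮ u, v`) are pairwise incompatible on
`D = {u ↮ v}`; together with `v ↔ b` they are sub-events of `B_v ∩ D`. Part 1: `O_u` vs `O_v` on `D`. [folklore] -/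
theorem disjoint_Ou_Ov (o b u v : V) :
    Disjoint (openConn o u ∩ openConn v b ∩ (openConn u v)ᶜ : Set (BondConfig V))
      (openConn o v ∩ openConn v b ∩ (openConn u v)ᶜ) := by
  rw [Set.disjoint_left]
  rintro ω ⟨⟨hou, _⟩, huv⟩ ⟨⟨hov, _⟩, _⟩
  simp only [mem_compl_iff, openConn, mem_setOf_eq] at hou hov huv
  exact huv (hou.symm.trans hov)

/-- Part 2: `O_u` vs `N ∩ O_c`. [folklore] -/
theorem disjoint_Ou_NOc (o b u v c : V) :
    Disjoint (openConn o u ∩ openConn v b ∩ (openConn u v)ᶜ : Set (BondConfig V))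
      ((openConn c u)ᶜ ∩ (openConn c v)ᶜ ∩ openConn o c ∩ openConn v b ∩ (openConn u v)ᶜ) := by
  rw [Set.disjoint_left]
  rintro ω ⟨⟨hou, _⟩, _⟩ ⟨⟨⟨⟨hcu, _⟩, hoc⟩, _⟩, _⟩
  simp only [mem_compl_iff, openConn, mem_setOf_eq] at hou hoc hcu
  exact hcu (hoc.symm.trans hou)

/-- Part 3: `O_v` vs `N ∩ O_c`. [folklore] -/
theorem disjoint_Ov_NOc (o b u v c : V) :
    Disjoint (openConn o v ∩ openConn v b ∩ (openConn u v)ᶜ : Set (BondConfig V))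
      ((openConn c u)ᶜ ∩ (openConn c v)ᶜ ∩ openConn o c ∩ openConn v b ∩ (openConn u v)ᶜ) := by
  rw [Set.disjoint_left]
  rintro ω ⟨⟨hov, _⟩, _⟩ ⟨⟨⟨⟨_, hcv⟩, hoc⟩, _⟩, _⟩
  simp only [mem_compl_iff, openConn, mem_setOf_eq] at hov hoc hcv
  exact hcv (hoc.symm.trans hov)

/-- The spectator's gain event contains the two crossed two-cluster events: `C_u ∩ B_v ∩ D ⊆ gain_c`. [folklore] -/
theorem CuBvD_subset_gain (b u v c : V) :
    (openConn c u ∩ openConn v b ∩ (openConn u v)ᶜ : Set (BondConfig V)) ⊆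
      (openConn c b)ᶜ ∩ (openConn c u ∪ openConn c v) ∩ (openConn u b ∪ openConn v b) := by
  rintro ω ⟨⟨hcu, hvb⟩, huv⟩
  simp only [mem_inter_iff, mem_union, mem_compl_iff, openConn, mem_setOf_eq] at hcu hvb huv ⊢
  exact ⟨⟨fun hcb => huv ((hcu.symm.trans hcb).trans hvb.symm), Or.inl hcu⟩, Or.inr hvb⟩

/-- Symmetric: `C_v ∩ B_u ∩ D ⊆ gain_c`. [folklore] -/
theorem CvBuD_subset_gain (b u v c : V) :
    (openConn c v ∩ openConn u b ∩ (openConn u v)ᶜ : Set (BondConfig V)) ⊆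
      (openConn c b)ᶜ ∩ (openConn c u ∪ openConn c v) ∩ (openConn u b ∪ openConn v b) := by
  rintro ω ⟨⟨hcv, hub⟩, huv⟩
  simp only [mem_inter_iff, mem_union, mem_compl_iff, openConn, mem_setOf_eq] at hcv hub huv ⊢
  exact ⟨⟨fun hcb => huv ((hub.trans hcb.symm).trans hcv), Or.inr hcv⟩, Or.inl hub⟩

/-- `C_u ∩ D` and `C_v ∩ D` are incompatible. [folklore] -/
theorem disjoint_CuBvD_CvBuD (b u v c : V) :
    Disjoint (openConn c u ∩ openConn v b ∩ (openConn u v)ᶜ : Set (BondConfig V))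
      (openConn c v ∩ openConn u b ∩ (openConn u v)ᶜ) := by
  rw [Set.disjoint_left]
  rintro ω ⟨⟨hcu, _⟩, huv⟩ ⟨⟨hcv, _⟩, _⟩
  simp only [mem_compl_iff, openConn, mem_setOf_eq] at hcu hcv huv
  exact huv (hcu.symm.trans hcv)

/-- On `D`, `o ↔ v` excludes `o ↔ u`: the events `X ∩ C_u` with `X = O_u ∩ B_v ∩ D` and `X' ∩ C_u` with
`X' = O_v ∩ B_v ∩ D` are disjoint. [folklore] -/
theorem disjoint_OuCu_OvCu (o b u v c : V) :
    Disjoint (openConn o u ∩ openConn v b ∩ (openConn u v)ᶜ ∩ openConn c u : Set (BondConfig V))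
      (openConn o v ∩ openConn v b ∩ (openConn u v)ᶜ ∩ openConn c u) :=
  (disjoint_Ou_Ov o b u v).mono inter_subset_left inter_subset_left

/-- Symmetric version with `u, v` exchanged in the observer/target positions. [folklore] -/
theorem disjoint_OvCv_OuCv (o b u v c : V) :
    Disjoint (openConn o v ∩ openConn u b ∩ (openConn u v)ᶜ ∩ openConn c v : Set (BondConfig V))
      (openConn o u ∩ openConn u b ∩ (openConn u v)ᶜ ∩ openConn c v) := by
  rw [Set.disjoint_left]
  rintro ω ⟨⟨⟨hov, _⟩, huv⟩, _⟩ ⟨⟨⟨hou, _⟩, _⟩, _⟩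
  simp only [mem_compl_iff, openConn, mem_setOf_eq] at hou hov huv
  exact huv (hou.symm.trans hov)

variable [Fintype V]

/-- **ML4 from SML4, ordered form** (`u` the weaker endpoint).  With the notation of the file header, if `τ_u ≤ τ_v` and
SML4 holds at `(o, b, u, v, c)` then `(ψ_A + ψ_c)·G_o ≤ ψ_A·(μ(B_u ∪ B_v) − τ_u) + ψ_c·G_c`.  Event inclusions and
additivity only. [cite: KozmaNitzan2024, Lemma 4 / eq. (8)–(9) (pp. 9–10)] -/
theorem ml4_of_sharp_ordered (w : Sym2 V → unitInterval) (o b u v c : V)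
    (hS : (prodBernoulli w).real ((openConn c u)ᶜ ∩ (openConn c v)ᶜ ∩ openConn o c) *
        ((prodBernoulli w).real (openConn o u ∩ openConn v b ∩ (openConn u v)ᶜ ∩ (openConn c u)ᶜ) +
          (prodBernoulli w).real (openConn o v ∩ openConn u b ∩ (openConn u v)ᶜ ∩ (openConn c v)ᶜ) -
          (prodBernoulli w).real (openConn o v ∩ openConn v b ∩ (openConn u v)ᶜ ∩ openConn c u) -
          (prodBernoulli w).real (openConn o u ∩ openConn u b ∩ (openConn u v)ᶜ ∩ openConn c v)) ≤
      (prodBernoulli w).real ((openConn c u)ᶜ ∩ (openConn c v)ᶜ ∩ (openConn o u ∪ openConn o v)) *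
        ((prodBernoulli w).real ((openConn c u)ᶜ ∩ (openConn c v)ᶜ ∩ openConn o c ∩ openConn v b ∩ (openConn u v)ᶜ) +
          (prodBernoulli w).real (openConn o v ∩ openConn v b ∩ (openConn u v)ᶜ) -
          (prodBernoulli w).real (openConn o v ∩ openConn u b ∩ (openConn u v)ᶜ))) :
    ((prodBernoulli w).real ((openConn c u)ᶜ ∩ (openConn c v)ᶜ ∩ (openConn o u ∪ openConn o v)) +
          (prodBernoulli w).real ((openConn c u)ᶜ ∩ (openConn c v)ᶜ ∩ openConn o c)) *
        (prodBernoulli w).real ((openConn o b)ᶜ ∩ (openConn o u ∪ openConn o v) ∩ (openConn u b ∪ openConn v b)) ≤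
      (prodBernoulli w).real ((openConn c u)ᶜ ∩ (openConn c v)ᶜ ∩ (openConn o u ∪ openConn o v)) *
          ((prodBernoulli w).real (openConn u b ∪ openConn v b) - (prodBernoulli w).real (openConn u b)) +
        (prodBernoulli w).real ((openConn c u)ᶜ ∩ (openConn c v)ᶜ ∩ openConn o c) *
          (prodBernoulli w).real ((openConn c b)ᶜ ∩ (openConn c u ∪ openConn c v) ∩ (openConn u b ∪ openConn v b)) := by
  have hm : ∀ s : Set (BondConfig V), MeasurableSet s := fun _ => MeasurableSet.of_discrete
  set μ := prodBernoulli w with hμ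
  set Ou : Set (BondConfig V) := openConn o u with hOu
  set Ov : Set (BondConfig V) := openConn o v with hOv
  set Oc : Set (BondConfig V) := openConn o c with hOc
  set Ob : Set (BondConfig V) := openConn o b with hOb
  set Bu : Set (BondConfig V) := openConn u b with hBu
  set Bv : Set (BondConfig V) := openConn v b with hBv
  set Bc : Set (BondConfig V) := openConn c b with hBc
  set Cu : Set (BondConfig V) := openConn c u with hCu
  set Cv : Set (BondConfig V) := openConn c v with hCv
  set D : Set (BondConfig V) := (openConn u v)ᶜ with hD
  -- (F1) the observer's gain is covered by the two crossed events
  have hF1 : μ.real (Obᶜ ∩ (Ou ∪ Ov) ∩ (Bu ∪ Bv)) ≤ μ.real (Ou ∩ Bv ∩ D) + μ.real (Ov ∩ Bu ∩ D) :=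
    (measureReal_mono (ObsLemma4Mult.gain_subset o b u v)).trans (measureReal_union_le _ _)
  -- (F2) `μ(B_u ∪ B_v) − τ_u = μ(B_v ∩ D)`
  have hF2 : μ.real (Bu ∪ Bv) - μ.real Bu = μ.real (Bv ∩ D) := by
    have h1 : μ.real (Bu ∪ Bv) = μ.real Bu + μ.real (Bv \ Bu) := by
      rw [← measureReal_union' disjoint_sdiff_right (hm Bu), union_sdiff_self]
    rw [h1, Bv_diff_Bu_eq b u v]
    ring
  -- (F3) three disjoint observer positions inside `B_v ∩ D`
  have hF3 : μ.real (Ou ∩ Bv ∩ D) + μ.real (Ov ∩ Bv ∩ D) + μ.real (Cuᶜ ∩ Cvᶜ ∩ Oc ∩ Bv ∩ D) ≤ μ.real (Bv ∩ D) := by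
    have h12 : Disjoint (Ou ∩ Bv ∩ D) (Ov ∩ Bv ∩ D) := disjoint_Ou_Ov o b u v
    have h13 : Disjoint (Ou ∩ Bv ∩ D) (Cuᶜ ∩ Cvᶜ ∩ Oc ∩ Bv ∩ D) := disjoint_Ou_NOc o b u v c
    have h23 : Disjoint (Ov ∩ Bv ∩ D) (Cuᶜ ∩ Cvᶜ ∩ Oc ∩ Bv ∩ D) := disjoint_Ov_NOc o b u v c
    have hu : μ.real ((Ou ∩ Bv ∩ D) ∪ (Ov ∩ Bv ∩ D) ∪ (Cuᶜ ∩ Cvᶜ ∩ Oc ∩ Bv ∩ D)) =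
        μ.real (Ou ∩ Bv ∩ D) + μ.real (Ov ∩ Bv ∩ D) + μ.real (Cuᶜ ∩ Cvᶜ ∩ Oc ∩ Bv ∩ D) := by
      rw [measureReal_union (h13.union_left h23) (hm _), measureReal_union h12 (hm _)]
    rw [← hu]
    refine measureReal_mono ?_
    refine union_subset (union_subset ?_ ?_) ?_
    · exact fun ω hω => ⟨hω.1.2, hω.2⟩
    · exact fun ω hω => ⟨hω.1.2, hω.2⟩
    · exact fun ω hω => ⟨hω.1.2, hω.2⟩
  -- (F4) the spectator's gain contains the two crossed events
  have hF4 : μ.real (Cu ∩ Bv ∩ D) + μ.real (Cv ∩ Bu ∩ D) ≤ μ.real (Bcᶜ ∩ (Cu ∪ Cv) ∩ (Bu ∪ Bv)) := by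
    rw [← measureReal_union (disjoint_CuBvD_CvBuD b u v c) (hm _)]
    exact measureReal_mono (union_subset (CuBvD_subset_gain b u v c) (CvBuD_subset_gain b u v c))
  -- (F5) splitting the crossed observer events along `C_u` / `C_v`
  have hsplit : ∀ A S : Set (BondConfig V), μ.real A = μ.real (A ∩ S) + μ.real (A ∩ Sᶜ) := by
    intro A S
    rw [← measureReal_inter_add_sdiff (s := A) (hm S), Set.sdiff_eq]
  have hF5a : μ.real (Ou ∩ Bv ∩ D) = μ.real (Ou ∩ Bv ∩ D ∩ Cu) + μ.real (Ou ∩ Bv ∩ D ∩ Cuᶜ) := hsplit _ Cu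
  have hF5b : μ.real (Ov ∩ Bu ∩ D) = μ.real (Ov ∩ Bu ∩ D ∩ Cv) + μ.real (Ov ∩ Bu ∩ D ∩ Cvᶜ) := hsplit _ Cv
  have hF6a : μ.real (Ou ∩ Bv ∩ D ∩ Cu) + μ.real (Ov ∩ Bv ∩ D ∩ Cu) ≤ μ.real (Cu ∩ Bv ∩ D) := by
    rw [← measureReal_union (disjoint_OuCu_OvCu o b u v c) (hm _)]
    refine measureReal_mono (union_subset ?_ ?_)
    · rintro ω ⟨⟨⟨_, hvb⟩, hd⟩, hcu⟩; exact ⟨⟨hcu, hvb⟩, hd⟩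
    · rintro ω ⟨⟨⟨_, hvb⟩, hd⟩, hcu⟩; exact ⟨⟨hcu, hvb⟩, hd⟩
  have hF6b : μ.real (Ov ∩ Bu ∩ D ∩ Cv) + μ.real (Ou ∩ Bu ∩ D ∩ Cv) ≤ μ.real (Cv ∩ Bu ∩ D) := by
    rw [← measureReal_union (disjoint_OvCv_OuCv o b u v c) (hm _)]
    refine measureReal_mono (union_subset ?_ ?_)
    · rintro ω ⟨⟨⟨_, hub⟩, hd⟩, hcv⟩; exact ⟨⟨hcv, hub⟩, hd⟩
    · rintro ω ⟨⟨⟨_, hub⟩, hd⟩, hcv⟩; exact ⟨⟨hcv, hub⟩, hd⟩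
  -- assemble
  rw [hF2]
  have hψA : 0 ≤ μ.real (Cuᶜ ∩ Cvᶜ ∩ (Ou ∪ Ov)) := measureReal_nonneg
  have hψc : 0 ≤ μ.real (Cuᶜ ∩ Cvᶜ ∩ Oc) := measureReal_nonneg
  have hGo : 0 ≤ μ.real (Obᶜ ∩ (Ou ∪ Ov) ∩ (Bu ∪ Bv)) := measureReal_nonneg
  -- ψ_A part: g1 + g2 ≤ μ(B_v ∩ D) − LHS
  have hA : μ.real (Ou ∩ Bv ∩ D) + μ.real (Ov ∩ Bu ∩ D) ≤
      μ.real (Bv ∩ D) - (μ.real (Cuᶜ ∩ Cvᶜ ∩ Oc ∩ Bv ∩ D) + μ.real (Ov ∩ Bv ∩ D) - μ.real (Ov ∩ Bu ∩ D)) := by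
    linarith
  -- ψ_c part: g1 + g2 − G_c ≤ RHS
  have hC : μ.real (Ou ∩ Bv ∩ D) + μ.real (Ov ∩ Bu ∩ D) ≤
      μ.real (Bcᶜ ∩ (Cu ∪ Cv) ∩ (Bu ∪ Bv)) +
        (μ.real (Ou ∩ Bv ∩ D ∩ Cuᶜ) + μ.real (Ov ∩ Bu ∩ D ∩ Cvᶜ) - μ.real (Ov ∩ Bv ∩ D ∩ Cu) -
          μ.real (Ou ∩ Bu ∩ D ∩ Cv)) := by
    linarith
  have k1 := mul_le_mul_of_nonneg_left hA hψA
  have k2 := mul_le_mul_of_nonneg_left hC hψc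
  have k0 := mul_le_mul_of_nonneg_left hF1 (add_nonneg hψA hψc)
  nlinarith [k0, k1, k2, hS]

/-- **ML4 from SML4** in the shape of the registered stubs: the sharp mixture inequality for every ordered pair `(u, v)` with
`τ_u ≤ τ_v` implies Kozma–Nitzan's mixture Lemma 4 `stub_mixtureLemma4_c8` for every pair `(a₁, a₂)` (the `min` picks the
weaker endpoint). [cite: KozmaNitzan2024, Lemma 4 / eq. (8)–(9) (pp. 9–10)] -/
theorem ml4_of_sharp
    (hS : ∀ (n : ℕ) (w : Sym2 (Fin n) → unitInterval) (o b u v c : Fin n),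
      (prodBernoulli w).real (openConn u b) ≤ (prodBernoulli w).real (openConn v b) →
      (prodBernoulli w).real ((openConn c u)ᶜ ∩ (openConn c v)ᶜ ∩ openConn o c) *
          ((prodBernoulli w).real (openConn o u ∩ openConn v b ∩ (openConn u v)ᶜ ∩ (openConn c u)ᶜ) +
            (prodBernoulli w).real (openConn o v ∩ openConn u b ∩ (openConn u v)ᶜ ∩ (openConn c v)ᶜ) -
            (prodBernoulli w).real (openConn o v ∩ openConn v b ∩ (openConn u v)ᶜ ∩ openConn c u) -
            (prodBernoulli w).real (openConn o u ∩ openConn u b ∩ (openConn u v)ᶜ ∩ openConn c v)) ≤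
        (prodBernoulli w).real ((openConn c u)ᶜ ∩ (openConn c v)ᶜ ∩ (openConn o u ∪ openConn o v)) *
          ((prodBernoulli w).real ((openConn c u)ᶜ ∩ (openConn c v)ᶜ ∩ openConn o c ∩ openConn v b ∩ (openConn u v)ᶜ) +
            (prodBernoulli w).real (openConn o v ∩ openConn v b ∩ (openConn u v)ᶜ) -
            (prodBernoulli w).real (openConn o v ∩ openConn u b ∩ (openConn u v)ᶜ))) :
    ∀ (n : ℕ) (w : Sym2 (Fin n) → unitInterval) (o b a₁ a₂ c : Fin n),
    ((prodBernoulli w).real ((openConn c a₁)ᶜ ∩ (openConn c a₂)ᶜ ∩ (openConn o a₁ ∪ openConn o a₂)) +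
          (prodBernoulli w).real ((openConn c a₁)ᶜ ∩ (openConn c a₂)ᶜ ∩ openConn o c)) *
        (prodBernoulli w).real ((openConn o b)ᶜ ∩ (openConn o a₁ ∪ openConn o a₂) ∩ (openConn a₁ b ∪ openConn a₂ b)) ≤
      (prodBernoulli w).real ((openConn c a₁)ᶜ ∩ (openConn c a₂)ᶜ ∩ (openConn o a₁ ∪ openConn o a₂)) *
          ((prodBernoulli w).real (openConn a₁ b ∪ openConn a₂ b) -
            min ((prodBernoulli w).real (openConn a₁ b)) ((prodBernoulli w).real (openConn a₂ b))) +
        (prodBernoulli w).real ((openConn c a₁)ᶜ ∩ (openConn c a₂)ᶜ ∩ openConn o c) *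
          (prodBernoulli w).real ((openConn c b)ᶜ ∩ (openConn c a₁ ∪ openConn c a₂) ∩ (openConn a₁ b ∪ openConn a₂ b)) := by
  intro n w o b a₁ a₂ c
  rcases le_total ((prodBernoulli w).real (openConn a₁ b)) ((prodBernoulli w).real (openConn a₂ b)) with h12 | h21
  · rw [min_eq_left h12]
    exact ml4_of_sharp_ordered w o b a₁ a₂ c (hS n w o b a₁ a₂ c h12)
  · rw [min_eq_right h21]
    have key := ml4_of_sharp_ordered w o b a₂ a₁ c (hS n w o b a₂ a₁ c h21)
    have e1 : ((openConn c a₂)ᶜ ∩ (openConn c a₁)ᶜ : Set (BondConfig (Fin n))) = (openConn c a₁)ᶜ ∩ (openConn c a₂)ᶜ :=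
      inter_comm _ _
    have e2 : (openConn o a₂ ∪ openConn o a₁ : Set (BondConfig (Fin n))) = openConn o a₁ ∪ openConn o a₂ := union_comm _ _
    have e3 : (openConn a₂ b ∪ openConn a₁ b : Set (BondConfig (Fin n))) = openConn a₁ b ∪ openConn a₂ b := union_comm _ _
    have e4 : (openConn c a₂ ∪ openConn c a₁ : Set (BondConfig (Fin n))) = openConn c a₁ ∪ openConn c a₂ := union_comm _ _
    rw [e1, e2, e3, e4] at key
    exact key

end SharpML4

/-- **`stub_mixtureLemma4_c8` from the sharp mixture inequality** (skeleton glue, lead c9): see `SharpML4.ml4_of_sharp`.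
[cite: KozmaNitzan2024, Lemma 4 / eq. (8)–(9) (pp. 9–10)] -/
theorem mixtureLemma4_of_sharp
    (hS : ∀ (n : ℕ) (w : Sym2 (Fin n) → unitInterval) (o b u v c : Fin n),
      (prodBernoulli w).real (openConn u b) ≤ (prodBernoulli w).real (openConn v b) →
      (prodBernoulli w).real ((openConn c u)ᶜ ∩ (openConn c v)ᶜ ∩ openConn o c) *
          ((prodBernoulli w).real (openConn o u ∩ openConn v b ∩ (openConn u v)ᶜ ∩ (openConn c u)ᶜ) +
            (prodBernoulli w).real (openConn o v ∩ openConn u b ∩ (openConn u v)ᶜ ∩ (openConn c v)ᶜ) -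
            (prodBernoulli w).real (openConn o v ∩ openConn v b ∩ (openConn u v)ᶜ ∩ openConn c u) -
            (prodBernoulli w).real (openConn o u ∩ openConn u b ∩ (openConn u v)ᶜ ∩ openConn c v)) ≤
        (prodBernoulli w).real ((openConn c u)ᶜ ∩ (openConn c v)ᶜ ∩ (openConn o u ∪ openConn o v)) *
          ((prodBernoulli w).real ((openConn c u)ᶜ ∩ (openConn c v)ᶜ ∩ openConn o c ∩ openConn v b ∩ (openConn u v)ᶜ) +
            (prodBernoulli w).real (openConn o v ∩ openConn v b ∩ (openConn u v)ᶜ) -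
            (prodBernoulli w).real (openConn o v ∩ openConn u b ∩ (openConn u v)ᶜ))) :
    ∀ (n : ℕ) (w : Sym2 (Fin n) → unitInterval) (o b a₁ a₂ c : Fin n),
    ((prodBernoulli w).real ((openConn c a₁)ᶜ ∩ (openConn c a₂)ᶜ ∩ (openConn o a₁ ∪ openConn o a₂)) +
          (prodBernoulli w).real ((openConn c a₁)ᶜ ∩ (openConn c a₂)ᶜ ∩ openConn o c)) *
        (prodBernoulli w).real ((openConn o b)ᶜ ∩ (openConn o a₁ ∪ openConn o a₂) ∩ (openConn a₁ b ∪ openConn a₂ b)) ≤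
      (prodBernoulli w).real ((openConn c a₁)ᶜ ∩ (openConn c a₂)ᶜ ∩ (openConn o a₁ ∪ openConn o a₂)) *
          ((prodBernoulli w).real (openConn a₁ b ∪ openConn a₂ b) -
            min ((prodBernoulli w).real (openConn a₁ b)) ((prodBernoulli w).real (openConn a₂ b))) +
        (prodBernoulli w).real ((openConn c a₁)ᶜ ∩ (openConn c a₂)ᶜ ∩ openConn o c) *
          (prodBernoulli w).real ((openConn c b)ᶜ ∩ (openConn c a₁ ∪ openConn c a₂) ∩ (openConn a₁ b ∪ openConn a₂ b)) :=
  SharpML4.ml4_of_sharp hS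

end

end Summit.CriticalPhenomena.PercolationContinuityZ3.Theorems
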